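import Summits.AtomisticToContinuum.Crystallization.Theorems.PalmUnimodularRigidityMinimiserShellsEnergyFloorC

/-!
# `StackingHinge` (stmt-AtomisticToContinuum-14993), line `Sketch`: stub `stub_hardCoreTail`

TRUNCATION PLUMBING. The `r⁻⁶` tail of a `δ`-separated configuration `S ⊆ ℝ³` (`0 < δ ≤ 1`)
beyond radius `L ≥ 1` is `≤ C δ⁻³ L⁻³`, as a `lintegral` against `count|S` restricted to
`{L ≤ ‖y‖}` (absolute constant `C = 3456`). Model: the whole-space bound
`lintegral_inv_norm_pow_six_le` of the `MinimiserShells` energy-floor line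
(`…PalmUnimodularRigidityMinimiserShellsEnergyFloorC`).

Proof. Reduce to finite partial sums (`lintegral_count_restrict_le_of_sum_le`, after
`Measure.restrict_restrict`). For a finite `T ⊆ S ∩ {L ≤ ‖y‖}`: dyadic layer cake
`‖z‖⁻⁶ ≤ 64 ∑_{k ≤ K, ‖z‖ < 2ᵏL} (2ᵏL)⁻⁶` (if `2ʲL ≤ ‖z‖ < 2ʲ⁺¹L` the single term `k = j + 1` is
`‖z‖⁻⁶ / 64`-large), exchange the two sums, and count the points of `T` in the ball of radius
`2ᵏL` by volume packing (`card_le_of_separated_of_dist_le`: at most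
`(2·2ᵏL/δ + 1)³ ≤ 27 · 8ᵏ L³ δ⁻³`); the `k`-th term is then `≤ 27 · 8⁻ᵏ δ⁻³ L⁻³ ≤ 27 · 2⁻ᵏ δ⁻³ L⁻³`
and `∑_{k ≤ K} 2⁻ᵏ ≤ 2`, whence `∑_{z ∈ T} ‖z‖⁻⁶ ≤ 64 · 27 · 2 · δ⁻³ L⁻³ = 3456 δ⁻³ L⁻³`.
-/

noncomputable section

open MeasureTheory
open scoped ENNReal BigOperators

namespace Summit.AtomisticToContinuum.Crystallization.Theorems.PricedHcpWindowsHardCoreTail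

open Literature.MathematicalPhysics.StatisticalMechanics (card_le_of_separated_of_dist_le)
open Summit.AtomisticToContinuum.Crystallization.Theorems.MinimiserShells.Negative.Rootedness
  (countable_of_separated)
open Summit.AtomisticToContinuum.Crystallization.Theorems.PalmUnimodularRigidityMinimiserShells.EnergyFloor
  (lintegral_count_restrict_le_of_sum_le)

variable {δ : ℝ}

/-- **Packing count in a ball about the origin.** A finite `δ`-separated set of points of `ℝ³`
has at most `27 R³ δ⁻³` points of norm `< R`, for `0 < δ ≤ R` (disjoint `δ/2`-balls inside the
ball of radius `R + δ/2`, `card_le_of_separated_of_dist_le`, and `2R/δ + 1 ≤ 3R/δ`). [folklore] -/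
theorem card_filter_norm_lt_le_of_sep (hδ : 0 < δ) (T : Finset (EuclideanSpace ℝ (Fin 3)))
    (hsep : ∀ x ∈ T, ∀ y ∈ T, x ≠ y → δ ≤ dist x y) {R : ℝ} (hR : δ ≤ R) :
    ((T.filter fun z => ‖z‖ < R).card : ℝ) ≤ 27 * R ^ 3 * δ⁻¹ ^ 3 := by
  have hR0 : 0 < R := hδ.trans_le hR
  have h := card_le_of_separated_of_dist_le (T.filter fun z => ‖z‖ < R) 0 hδ hR0.le
    (fun c hc => by
      rw [dist_zero_right]
      exact (Finset.mem_filter.1 hc).2.le)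
    (fun c hc d hd hcd => hsep c (Finset.mem_filter.1 hc).1 d (Finset.mem_filter.1 hd).1 hcd)
  rw [finrank_euclideanSpace_fin] at h
  have h1 : 1 ≤ R / δ := (one_le_div hδ).2 hR
  have h2 : 2 * R / δ + 1 ≤ 3 * R / δ := by
    calc 2 * R / δ + 1 ≤ 2 * R / δ + R / δ := by linarith
      _ = 3 * R / δ := by ring
  calc ((T.filter fun z => ‖z‖ < R).card : ℝ) ≤ (2 * R / δ + 1) ^ 3 := h
    _ ≤ (3 * R / δ) ^ 3 := pow_le_pow_left₀ (by positivity) h2 3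
    _ = 27 * R ^ 3 * δ⁻¹ ^ 3 := by ring

/-- **Dyadic layer cake.** If `L ≤ ‖z‖ < 2ᴷ L` (`0 < L`), then
`‖z‖⁻⁶ ≤ 64 ∑_{k ≤ K, ‖z‖ < 2ᵏL} (2ᵏL)⁻⁶`: for the least `k₀ = j + 1` with `‖z‖ < 2^{k₀} L` one has
`2ʲ L ≤ ‖z‖`, so the `k₀`-th term alone is `≥ ‖z‖⁻⁶ / 64`. [folklore] -/
theorem inv_norm_pow_six_le_dyadicSum {L : ℝ} (hL : 0 < L) {K : ℕ}
    {z : EuclideanSpace ℝ (Fin 3)} (hLz : L ≤ ‖z‖) (hzK : ‖z‖ < 2 ^ K * L) :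
    ‖z‖⁻¹ ^ 6 ≤ 64 * ∑ k ∈ Finset.range (K + 1),
      (if ‖z‖ < 2 ^ k * L then ((2 : ℝ) ^ k * L)⁻¹ ^ 6 else 0) := by
  classical
  have hex : ∃ k : ℕ, ‖z‖ < 2 ^ k * L := ⟨K, hzK⟩
  have hk₀K : Nat.find hex ≤ K := Nat.find_min' hex hzK
  have hspec : ‖z‖ < 2 ^ (Nat.find hex) * L := Nat.find_spec hex
  have hk₀0 : Nat.find hex ≠ 0 := by
    intro h0
    rw [h0, pow_zero, one_mul] at hspec
    exact absurd hLz (not_le.2 hspec)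
  obtain ⟨j, hj⟩ : ∃ j : ℕ, Nat.find hex = j + 1 := ⟨Nat.find hex - 1, by omega⟩
  have hjlt : ¬ ‖z‖ < 2 ^ j * L := Nat.find_min hex (by omega)
  have hjle : 2 ^ j * L ≤ ‖z‖ := not_lt.1 hjlt
  have hpos : 0 < (2 : ℝ) ^ j * L := by positivity
  have hterm : ‖z‖⁻¹ ^ 6 ≤ 64 * ((2 : ℝ) ^ (Nat.find hex) * L)⁻¹ ^ 6 := by
    have h1 : ‖z‖⁻¹ ^ 6 ≤ ((2 : ℝ) ^ j * L)⁻¹ ^ 6 :=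
      pow_le_pow_left₀ (inv_nonneg.2 (norm_nonneg _)) (inv_anti₀ hpos hjle) 6
    have h2 : ((2 : ℝ) ^ j * L)⁻¹ ^ 6 = 64 * ((2 : ℝ) ^ (Nat.find hex) * L)⁻¹ ^ 6 := by
      have h3 : (2 : ℝ) ^ (Nat.find hex) * L = 2 * (2 ^ j * L) := by rw [hj]; ring
      rw [h3]
      field_simp
      ring
    exact h1.trans_eq h2
  have hmem : Nat.find hex ∈ Finset.range (K + 1) := Finset.mem_range.2 (Nat.lt_succ_of_le hk₀K)
  have hsingle : ((2 : ℝ) ^ (Nat.find hex) * L)⁻¹ ^ 6 ≤ ∑ k ∈ Finset.range (K + 1),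
      (if ‖z‖ < 2 ^ k * L then ((2 : ℝ) ^ k * L)⁻¹ ^ 6 else 0) := by
    calc ((2 : ℝ) ^ (Nat.find hex) * L)⁻¹ ^ 6
        = (if ‖z‖ < 2 ^ (Nat.find hex) * L then ((2 : ℝ) ^ (Nat.find hex) * L)⁻¹ ^ 6 else 0) :=
          (if_pos hspec).symm
      _ ≤ ∑ k ∈ Finset.range (K + 1),
            (if ‖z‖ < 2 ^ k * L then ((2 : ℝ) ^ k * L)⁻¹ ^ 6 else 0) :=
          Finset.single_le_sum
            (f := fun k => if ‖z‖ < 2 ^ k * L then ((2 : ℝ) ^ k * L)⁻¹ ^ 6 else 0)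
            (fun k _ => by positivity) hmem
  linarith

/-- **The `r⁻⁶` tail over a separated set, finite sums.** For a finite `δ`-separated set `T` of
points of norm `≥ L` in `ℝ³` (`0 < δ ≤ 1 ≤ L`): `∑_{z ∈ T} ‖z‖⁻⁶ ≤ 3456 δ⁻³ L⁻³` (dyadic layer
cake, exchange of sums, packing count per dyadic ball, geometric series). [folklore] -/
theorem sum_inv_norm_pow_six_tail_le (hδ : 0 < δ) (hδ1 : δ ≤ 1)
    (T : Finset (EuclideanSpace ℝ (Fin 3))) (hsep : ∀ x ∈ T, ∀ y ∈ T, x ≠ y → δ ≤ dist x y)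
    {L : ℝ} (hL : 1 ≤ L) (hT : ∀ z ∈ T, L ≤ ‖z‖) :
    ∑ z ∈ T, ‖z‖⁻¹ ^ 6 ≤ 3456 * δ⁻¹ ^ 3 * L⁻¹ ^ 3 := by
  classical
  have hL0 : 0 < L := one_pos.trans_le hL
  -- a dyadic radius beyond all points of `T`
  obtain ⟨K, hK⟩ : ∃ K : ℕ, ∀ z ∈ T, ‖z‖ < 2 ^ K * L := by
    obtain ⟨K, hK⟩ := pow_unbounded_of_one_lt ((∑ z ∈ T, ‖z‖) / L) (one_lt_two (α := ℝ))
    refine ⟨K, fun z hz => ?_⟩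
    have h1 : ‖z‖ ≤ ∑ w ∈ T, ‖w‖ := Finset.single_le_sum (fun w _ => norm_nonneg w) hz
    rw [div_lt_iff₀ hL0] at hK
    linarith
  set g : ℕ → EuclideanSpace ℝ (Fin 3) → ℝ := fun k z =>
    if ‖z‖ < 2 ^ k * L then ((2 : ℝ) ^ k * L)⁻¹ ^ 6 else 0 with hg
  -- pointwise dyadic layer cake
  have step1 : ∑ z ∈ T, ‖z‖⁻¹ ^ 6 ≤ ∑ z ∈ T, 64 * ∑ k ∈ Finset.range (K + 1), g k z :=
    Finset.sum_le_sum fun z hz => inv_norm_pow_six_le_dyadicSum hL0 (hT z hz) (hK z hz)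
  -- exchange the sums
  have step2 : ∑ z ∈ T, 64 * ∑ k ∈ Finset.range (K + 1), g k z =
      64 * ∑ k ∈ Finset.range (K + 1),
        ((2 : ℝ) ^ k * L)⁻¹ ^ 6 * ((T.filter fun z => ‖z‖ < 2 ^ k * L).card : ℝ) := by
    rw [← Finset.mul_sum, Finset.sum_comm]
    congr 1
    refine Finset.sum_congr rfl fun k _ => ?_
    simp only [hg]
    rw [← Finset.sum_filter, Finset.sum_const, nsmul_eq_mul]
    ring
  -- count per dyadic ball
  have step3 : ∀ k ∈ Finset.range (K + 1),
      ((2 : ℝ) ^ k * L)⁻¹ ^ 6 * ((T.filter fun z => ‖z‖ < 2 ^ k * L).card : ℝ) ≤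
        27 * δ⁻¹ ^ 3 * L⁻¹ ^ 3 * (1 / 2) ^ k := by
    intro k _
    have h2k : (1 : ℝ) ≤ 2 ^ k := one_le_pow₀ one_le_two
    have hu1 : L ≤ 2 ^ k * L := le_mul_of_one_le_left hL0.le h2k
    have hu0 : 0 < (2 : ℝ) ^ k * L := hL0.trans_le hu1
    have hδu : δ ≤ 2 ^ k * L := hδ1.trans (hL.trans hu1)
    have hcard := card_filter_norm_lt_le_of_sep hδ T hsep hδu
    have h6 : 0 ≤ ((2 : ℝ) ^ k * L)⁻¹ ^ 6 := by positivity
    have h2k0 : (2 : ℝ) ^ k ≠ 0 := by positivity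
    calc ((2 : ℝ) ^ k * L)⁻¹ ^ 6 * ((T.filter fun z => ‖z‖ < 2 ^ k * L).card : ℝ)
        ≤ ((2 : ℝ) ^ k * L)⁻¹ ^ 6 * (27 * (2 ^ k * L) ^ 3 * δ⁻¹ ^ 3) :=
          mul_le_mul_of_nonneg_left hcard h6
      _ = 27 * δ⁻¹ ^ 3 * L⁻¹ ^ 3 * ((2 : ℝ) ^ k)⁻¹ ^ 3 := by
          field_simp
      _ ≤ 27 * δ⁻¹ ^ 3 * L⁻¹ ^ 3 * ((2 : ℝ) ^ k)⁻¹ := by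
          refine mul_le_mul_of_nonneg_left ?_ (by positivity)
          exact pow_le_of_le_one (by positivity) (inv_le_one_of_one_le₀ h2k) three_ne_zero
      _ = 27 * δ⁻¹ ^ 3 * L⁻¹ ^ 3 * (1 / 2) ^ k := by rw [one_div, inv_pow (2 : ℝ) k]
  -- geometric series
  have step4 : ∑ k ∈ Finset.range (K + 1), 27 * δ⁻¹ ^ 3 * L⁻¹ ^ 3 * (1 / 2 : ℝ) ^ k ≤
      27 * δ⁻¹ ^ 3 * L⁻¹ ^ 3 * 2 := by
    rw [← Finset.mul_sum]
    exact mul_le_mul_of_nonneg_left (sum_geometric_two_le _) (by positivity)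
  calc ∑ z ∈ T, ‖z‖⁻¹ ^ 6 ≤ ∑ z ∈ T, 64 * ∑ k ∈ Finset.range (K + 1), g k z := step1
    _ = 64 * ∑ k ∈ Finset.range (K + 1),
        ((2 : ℝ) ^ k * L)⁻¹ ^ 6 * ((T.filter fun z => ‖z‖ < 2 ^ k * L).card : ℝ) := step2
    _ ≤ 64 * ∑ k ∈ Finset.range (K + 1), 27 * δ⁻¹ ^ 3 * L⁻¹ ^ 3 * (1 / 2 : ℝ) ^ k :=
        mul_le_mul_of_nonneg_left (Finset.sum_le_sum step3) (by norm_num)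
    _ ≤ 64 * (27 * δ⁻¹ ^ 3 * L⁻¹ ^ 3 * 2) := mul_le_mul_of_nonneg_left step4 (by norm_num)
    _ = 3456 * δ⁻¹ ^ 3 * L⁻¹ ^ 3 := by ring

/-- **stub_hardCoreTail** (truncation plumbing of line `Sketch`). There is an absolute constant `C`
(here `C = 3456`) such that for every `δ ∈ (0, 1]`, every `δ`-separated `S ⊆ ℝ³` and every
`L ≥ 1`, the `r⁻⁶` tail of the configuration `count|S` beyond radius `L` is at most `C δ⁻³ L⁻³`:
`∫⁻_{L ≤ ‖y‖} ‖y‖⁻⁶ d(count|S) ≤ C δ⁻³ L⁻³` (finite partial sums `sum_inv_norm_pow_six_tail_le` and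
`lintegral_count_restrict_le_of_sum_le`). [folklore] -/
theorem stub_hardCoreTail : ∃ C : ℝ, 0 ≤ C ∧ ∀ δ : ℝ, 0 < δ → δ ≤ 1 → ∀ S : Set (EuclideanSpace ℝ (Fin 3)), (∀ x ∈ S, ∀ y ∈ S, x ≠ y → δ ≤ dist x y) → ∀ L : ℝ, 1 ≤ L → ∫⁻ y in {y : EuclideanSpace ℝ (Fin 3) | L ≤ ‖y‖}, ENNReal.ofReal (‖y‖⁻¹ ^ 6) ∂((MeasureTheory.Measure.count : MeasureTheory.Measure (EuclideanSpace ℝ (Fin 3))).restrict S) ≤ ENNReal.ofReal (C * δ⁻¹ ^ 3 * L⁻¹ ^ 3) := by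
  refine ⟨3456, by norm_num, fun δ hδ hδ1 S hsep L hL => ?_⟩
  have hA : MeasurableSet {y : EuclideanSpace ℝ (Fin 3) | L ≤ ‖y‖} :=
    measurableSet_le measurable_const measurable_norm
  rw [Measure.restrict_restrict hA]
  refine lintegral_count_restrict_le_of_sum_le
    ((countable_of_separated hδ hsep).mono Set.inter_subset_right) fun T hT => ?_
  rw [← ENNReal.ofReal_sum_of_nonneg fun z _ => by positivity]
  refine ENNReal.ofReal_le_ofReal (sum_inv_norm_pow_six_tail_le hδ hδ1 T ?_ hL ?_)
  · exact fun x hx y hy hxy => hsep x (hT hx).2 y (hT hy).2 hxy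
  · exact fun z hz => (hT hz).1

end Summit.AtomisticToContinuum.Crystallization.Theorems.PricedHcpWindowsHardCoreTail

end
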